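import Literature.Geometry.Symplectic.OrigamiUnfoldingOfNormalForm
import Literature.Geometry.Symplectic.OrigamiCollarNormalFormProofs
import HarnessLib

/-!
# Discharged fact: the symplectic cut pieces of an origami `4`-manifold exist
# (Cannas da Silva–Guillemin–Pires 2010, Prop. 2.8, from the origami normal form CdS–G–Woodward 2000)

`Literature.Geometry.Symplectic.exists_symplecticCutPieces_of_isOrigamiForm`
(`Geometry/Symplectic/OrigamiUnfolding`) was reduced in the tree, at universe `0`, to the origami
collar normal form `exists_origamiCollarNormalForm` (Cannas da Silva–Guillemin–Woodward 2000, Thm. 1)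
by `exists_symplecticCutPieces_of_normalForm` (`OrigamiUnfoldingOfNormalForm`); the normal form is a
theorem of the tree (`exists_origamiCollarNormalForm_holds`, `OrigamiCollarNormalFormProofs`, folded
Moser argument).  One-line application at universe `0` (the universe of the reduction); no statement
is changed; no definition, no new named fact (D-0026).

## References

* A. Cannas da Silva, V. Guillemin, A. R. Pires, *Symplectic origami*, IMRN 2011 (2010 preprint),
  Prop. 2.8 with Def. 2.13 and proof of Prop. 2.26. [CannasdasilvaGuilleminPires2010]
-/

namespace Literature.Geometry.Symplectic

/-- **Cannas da Silva–Guillemin–Pires, Prop. 2.8: the two symplectic cut pieces of an oriented origami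
manifold exist — the named fact `exists_symplecticCutPieces_of_isOrigamiForm` holds (universe `0`)**
(`exists_symplecticCutPieces_of_normalForm` applied to `exists_origamiCollarNormalForm_holds`).
[cite: CannasdasilvaGuilleminPires2010, Prop. 2.8 with Def. 2.13 and proof of Prop. 2.26] -/
theorem exists_symplecticCutPieces_of_isOrigamiForm_holds :
    exists_symplecticCutPieces_of_isOrigamiForm.{0} :=
  exists_symplecticCutPieces_of_normalForm exists_origamiCollarNormalForm_holds

end Literature.Geometry.Symplectic
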